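import Summits.CriticalPhenomena.PercolationContinuityZ3.Theorems.Transplant.SkelFrmQuasiBChoiceZoneK
import Summits.CriticalPhenomena.PercolationContinuityZ3.Theorems.Transplant.SkelFrmQuasiBChoiceLinksPx
import Summits.CriticalPhenomena.PercolationContinuityZ3.Theorems.Transplant.SkelFrmFromBChoiceZoneKPx
import Summits.CriticalPhenomena.PercolationContinuityZ3.Theorems.Transplant.PlanarSkeletonFrmQuasiDefs
import Summits.CriticalPhenomena.PercolationContinuityZ3.Theorems.Transplant.PlanarSkeletonFrmQuasiProx
import Summits.CriticalPhenomena.PercolationContinuityZ3.Theorems.Transplant.PlanarSkeletonFrmQuasiProxies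
import Summits.CriticalPhenomena.PercolationContinuityZ3.Theorems.Transplant.SkelFrmQuasi1ChoiceDefs
import Summits.CriticalPhenomena.PercolationContinuityZ3.Theorems.Transplant.SkelFrmQuasi1ParamsLBL
import Summits.CriticalPhenomena.PercolationContinuityZ3.Theorems.Transplant.SkelFrmQuasi1ParamsPO
import Summits.CriticalPhenomena.PercolationContinuityZ3.Theorems.Transplant.SkelFrmQuasi1SlotTypes
import Summits.CriticalPhenomena.PercolationContinuityZ3.Theorems.Transplant.SkelFrmQuasiBChoiceAtQPx
import Summits.CriticalPhenomena.PercolationContinuityZ3.Theorems.Transplant.SkelFrmQuasiBChoiceDefs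
import Summits.CriticalPhenomena.PercolationContinuityZ3.Theorems.Transplant.SkelFrmQuasiBChoiceDefs3
import Summits.CriticalPhenomena.PercolationContinuityZ3.Theorems.Transplant.SkelFrmQuasiBChoiceKit
import Summits.CriticalPhenomena.PercolationContinuityZ3.Theorems.Transplant.SkelFrmQuasiBChoiceLinks
import Summits.CriticalPhenomena.PercolationContinuityZ3.Theorems.Transplant.SkelFrmQuasiBParamsLF
import Summits.CriticalPhenomena.PercolationContinuityZ3.Theorems.Transplant.SkelFrmQuasiBParamsLO
import Summits.CriticalPhenomena.PercolationContinuityZ3.Theorems.Transplant.SkelFrmQuasiBParamsSlotsRS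
import Summits.CriticalPhenomena.PercolationContinuityZ3.Theorems.Transplant.SkelFrmQuasi1SlotTypes
import HarnessLib

/-!
# GEN-Q PORT (WAVE-Q table v0.8 section 2, row G272, U-level L?; captain R-6/R-7 2026-08-27: carrier token swap `PlanarSkeletonFrmFrom ↦ PlanarSkeletonFrmQuasi`)
# of the tree module «Transplant/SkelFrmFromBChoiceZoneKPx» (sha256 832f2a450a6f75ca…) onto the quasi-step carrier `PlanarSkeletonFrmQuasi` (p507026): «SkelFrmQuasiBChoiceZoneKPx»

ORIGINAL TITLE: 

builds on p205010 (kernel theorem, internal audit signed; external expert review pending) — nothing in this file uses p205010; NOTHING is claimed about any open node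
((N3-b), the end state).  Lane `prim-bschramm`, seat `prim-bschramm-gen-1` (gen 5; WAVE-Q captain).  Helper file (`--supports stmt-CriticalPhenomena-4575 --as helper`).
PORT RULES (U-wave r1–r4 re-used, GEN-Q hunk classes of p3-g29 #6136): declaration order, names and proof texts are those of «SkelFrmFromBChoiceZoneKPx», byte-identical except
(i) the carrier token `PlanarSkeletonFrmFrom ↦ PlanarSkeletonFrmQuasi` in binders, `namespace`/`end` lines and qualified names (module names `SkelFrmFrom… ↦ SkelFrmQuasi…`
in imports of already-ported rows); (ii) `Φ.step ↦ Φ.qstep` with the called Steps lemma replaced by its `…Q`/`_q` twin and the cost `Φ.M` threaded (none in this file unless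
listed below); (iii) `Φ.cyl_connected ↦ Φ.cyl_reach` readers (none unless listed); (iv) graph-ball radii / window floors ×`Φ.M` (none unless listed); r2 (U-wave rule re-used, p3-g30's inline_r2.py): section `variable` binders that bind the carrier are inlined into the kept headers (the gate's dedup otherwise reads a carrier-free header as a restatement of the FrmFrom twin — p539450).  Carrier-free
residents stay imported/exported from the original «SkelFrmBChoiceZoneKPx» exactly as in the FrmFrom port.  Docstrings and citations are the original's.
Row G272 (gen-1 g5).
-/

noncomputable section

open scoped Classical

namespace Summit.CriticalPhenomena.PercolationContinuityZ3.Theorems.Transplant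

open MeasureTheory Literature.Probability.Percolation Literature.Probability.LatticeModels SimpleGraph KNCells KNLevels
open Literature.Barriers.CriticalPhenomena (graphBall graphBall_mono)
open SkelConc (Consts)
open Skelφ (oriφ trφ lip_oriφ)
open Skelφ.StepI (DataN DataNS OutNS)

namespace PlanarSkeletonFrmQuasi

export PlanarSkeletonFrmFrom.NegB (RK RgK Rs hKit nKit φK)  -- T3-auto: resident alias(es) replicated from the FrmFrom namespace
export PlanarSkeletonFrmFrom.Neg (φL)  -- T3-auto: resident alias(es) replicated from the FrmFrom namespace

namespace NegB

open Neg

section ZoneKPx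

export PlanarSkeletonFrmFrom.NegB (mem_graphBall_trans)

variable {κ : Consts} {V : Type} [DecidableEq V] [Countable V] {G : SimpleGraph V} [G.LocallyFinite] {Φ : PlanarSkeletonFrmQuasi G} {t : V} {p : unitInterval}
  {hC : Φ.CylSubcritical p} {gv fv : Neg.FSlot} {Pv : PSlot} {Sv : SSlot} {cv : CSlot} {bv : BSlot} {O : OutNS V} {q : unitInterval} {D : ℕ}

/-! ## §1 The zone datum of `Λ ∘ prox` at the seed level `k` -/

/-- **`hcz` under proxies**: every centre lies in its consumer-side seed-level zone `Λ (prox c) k` once `D ≤ k` (the floor of hunk (iii)). [this work] -/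
theorem hczK_of_atQPx {κ : Consts} {V : Type} [DecidableEq V] [Countable V] {G : SimpleGraph V} [G.LocallyFinite] {Φ : PlanarSkeletonFrmQuasi G} {t : V} {p : unitInterval} {hC : Φ.CylSubcritical p} {gv : Neg.FSlot} {fv : Neg.FSlot} {Pv : PSlot} {Sv : SSlot} {cv : CSlot} {bv : BSlot} {O : OutNS V} {q : unitInterval} {D : ℕ} (hAt : (choiceAtQ3 κ Φ t p Pv gv fv Sv cv bv hC).AtQNQ O q) (hP : Φ.HasProxies t D) (hD : D ≤ O.merged.k) :
    ∀ c, c ∈ O.merged.Λ (hP.prox c) O.merged.k := by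
  intro c
  rw [zoneK_eq_fatSeq hAt (hP.prox c)]
  exact hP.mem_fatSeq_prox hC c hD

/-- **`hzconn` under proxies**: the consumer-side seed-level zone is connected from the CENTRE `c` inside itself (`D ≤ k`: both `c` and the target lie in the fat
prism about `prox c`, which is internally connected). [this work] -/
theorem hzconnK_of_atQPx {κ : Consts} {V : Type} [DecidableEq V] [Countable V] {G : SimpleGraph V} [G.LocallyFinite] {Φ : PlanarSkeletonFrmQuasi G} {t : V} {p : unitInterval} {hC : Φ.CylSubcritical p} {gv : Neg.FSlot} {fv : Neg.FSlot} {Pv : PSlot} {Sv : SSlot} {cv : CSlot} {bv : BSlot} {O : OutNS V} {q : unitInterval} {D : ℕ} (hAt : (choiceAtQ3 κ Φ t p Pv gv fv Sv cv bv hC).AtQNQ O q) (hP : Φ.HasProxies t D) (hD : D ≤ O.merged.k) :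
    ∀ c, ∀ s ∈ O.merged.Λ (hP.prox c) O.merged.k, PathIn G (↑(O.merged.Λ (hP.prox c) O.merged.k) : Set V) c s := by
  intro c s hs
  have e := zoneK_eq_fatSeq hAt (hP.prox c)
  have eset : (↑(O.merged.Λ (hP.prox c) O.merged.k) : Set V) = Skelφ.cylBall G Φ.φ (hP.prox c) O.merged.k (Skelφ.fatRadius Φ.frame hC O.merged.k) := by
    ext v; rw [Finset.mem_coe, e, Skelφ.mem_fatSeq_iff]
  rw [eset]
  have hs' : s ∈ Skelφ.cylBall G Φ.φ (hP.prox c) O.merged.k (Skelφ.fatRadius Φ.frame hC O.merged.k) := by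
    rw [e, Skelφ.mem_fatSeq_iff] at hs; exact hs
  have hc' : c ∈ Skelφ.cylBall G Φ.φ (hP.prox c) O.merged.k (Skelφ.fatRadius Φ.frame hC O.merged.k) := by
    have h := hczK_of_atQPx hAt hP hD c
    rw [e, Skelφ.mem_fatSeq_iff] at h; exact h
  exact Skelφ.pathIn_cylBall' (G := G) (φ := Φ.φ) hc' hs'

/-- **`hZρ` under proxies**: the consumer-side seed-level zone lies in `B(c, fatRadius k + D)` (triangle through the proxy; radius slot `+ D`). [this work] -/
theorem hZρK_of_atQPx {κ : Consts} {V : Type} [DecidableEq V] [Countable V] {G : SimpleGraph V} [G.LocallyFinite] {Φ : PlanarSkeletonFrmQuasi G} {t : V} {p : unitInterval} {hC : Φ.CylSubcritical p} {gv : Neg.FSlot} {fv : Neg.FSlot} {Pv : PSlot} {Sv : SSlot} {cv : CSlot} {bv : BSlot} {O : OutNS V} {q : unitInterval} {D : ℕ} (hAt : (choiceAtQ3 κ Φ t p Pv gv fv Sv cv bv hC).AtQNQ O q) (hP : Φ.HasProxies t D) (c : V) :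
    ∀ a ∈ O.merged.Λ (hP.prox c) O.merged.k, a ∈ graphBall G c (D + Skelφ.fatRadius Φ.frame hC O.merged.k) :=
  fun a ha => mem_graphBall_trans (Skelφ.mem_graphBall_comm (hP.mem_graphBall_prox c)) (hZρK_of_atQ hAt (hP.prox c) a ha)

-- GEN-Q (R-2, captain 2026-08-27): `PlanarSkeletonFrmFrom.NegB.hZρK_Rs_of_atQPx` is not in the used cone of the node top — not ported.

/-- The consumer-side seed-level zone inside the cylinder of `φL` of half-width `k` ABOUT `c` (chart-level: the cylinders about `c` and `prox c` coincide). [this work] -/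
theorem zoneK_subset_cyl_φL_Px {κ : Consts} {V : Type} [DecidableEq V] [Countable V] {G : SimpleGraph V} [G.LocallyFinite] {Φ : PlanarSkeletonFrmQuasi G} {t : V} {p : unitInterval} {hC : Φ.CylSubcritical p} {gv : Neg.FSlot} {fv : Neg.FSlot} {Pv : PSlot} {Sv : SSlot} {cv : CSlot} {bv : BSlot} {O : OutNS V} {q : unitInterval} {D : ℕ} (hAt : (choiceAtQ3 κ Φ t p Pv gv fv Sv cv bv hC).AtQNQ O q) (hP : Φ.HasProxies t D) (c : V) :
    (↑(O.merged.Λ (hP.prox c) O.merged.k) : Set V) ⊆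
      Skelφ.cyl (φL κ Φ t p O.D O.DT.toDataN O.ori (gOf κ Φ t p O gv) (fOf κ Φ t p O fv)) c O.merged.k := by
  have e : Skelφ.cyl (φL κ Φ t p O.D O.DT.toDataN O.ori (gOf κ Φ t p O gv) (fOf κ Φ t p O fv)) c O.merged.k =
      Skelφ.cyl (φL κ Φ t p O.D O.DT.toDataN O.ori (gOf κ Φ t p O gv) (fOf κ Φ t p O fv)) (hP.prox c) O.merged.k :=
    (Skelφ.cyl_eq_of_apply_eq (hP.oriφ_prox _ c) _).symm
  rw [e]
  exact zoneK_subset_cyl_φL hAt (hP.prox c)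

/-- **`hΛRg` under proxies, PRISM FORM**: the consumer-side zone at `M_u` lies in the kit parallelogram ABOUT `c` with the kit radius `RK + D` (the U twin's
`Λ ⊆ RgK` at `prox c`, transported by `Skelφ.pgramPrism_subset_add`; width floor `D ≤ nKit`).  This is hunk (iv) `Rs ↦ Rs + D` at its source. [this work] -/
theorem hΛRg_of_atQPx {κ : Consts} {V : Type} [DecidableEq V] [Countable V] {G : SimpleGraph V} [G.LocallyFinite] {Φ : PlanarSkeletonFrmQuasi G} {t : V} {p : unitInterval} {hC : Φ.CylSubcritical p} {gv : Neg.FSlot} {fv : Neg.FSlot} {Pv : PSlot} {Sv : SSlot} {cv : CSlot} {bv : BSlot} {O : OutNS V} {q : unitInterval} {D : ℕ} (mk : ℕ) (hAt : (choiceAtQ3 κ Φ t p Pv gv fv Sv cv bv hC).AtQNQ O q) (hP : Φ.HasProxies t D) (hn : D ≤ KS.nKit O.merged mk) :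
    ∀ c, (↑(O.merged.Λ (hP.prox c) (Mu O.merged)) : Set V) ⊆
      Skelφ.pgramPrism G (KS.φK Φ t O.D O.DT.toDataN O.ori mk) c (KS.nKit O.merged mk) (KS.hKit t O.merged mk) (3 * KS.ℓKit t O.merged mk)
        (KS.RK t O.merged mk + D) := by
  intro c a ha
  have hU := hΛRg_of_atQ mk hAt (hP.prox c) (Finset.mem_coe.1 ha)
  unfold KS.RgK at hU
  rw [Skelφ.mem_pgramPrismFin] at hU
  exact Skelφ.pgramPrism_subset_add (lip_oriφ Φ.lip _) (hP.oriφ_prox _ c) (hP.mem_graphBall_prox c) hn _ _ _ hU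

/-- The seed-level zone under proxies inside the same kit parallelogram about `c` (`Λ (prox c) k ⊆ Λ (prox c) M_u`). [folklore] -/
theorem hΛRgK_of_atQPx {κ : Consts} {V : Type} [DecidableEq V] [Countable V] {G : SimpleGraph V} [G.LocallyFinite] {Φ : PlanarSkeletonFrmQuasi G} {t : V} {p : unitInterval} {hC : Φ.CylSubcritical p} {gv : Neg.FSlot} {fv : Neg.FSlot} {Pv : PSlot} {Sv : SSlot} {cv : CSlot} {bv : BSlot} {O : OutNS V} {q : unitInterval} {D : ℕ} (mk : ℕ) (hAt : (choiceAtQ3 κ Φ t p Pv gv fv Sv cv bv hC).AtQNQ O q) (hP : Φ.HasProxies t D) (hn : D ≤ KS.nKit O.merged mk) :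
    ∀ c, (↑(O.merged.Λ (hP.prox c) O.merged.k) : Set V) ⊆
      Skelφ.pgramPrism G (KS.φK Φ t O.D O.DT.toDataN O.ori mk) c (KS.nKit O.merged mk) (KS.hKit t O.merged mk) (3 * KS.ℓKit t O.merged mk)
        (KS.RK t O.merged mk + D) :=
  fun c _ ha => hΛRg_of_atQPx mk hAt hP hn c (Finset.mem_coe.2 (zone_k_subset_zone_Mu hAt (hP.prox c) (Finset.mem_coe.1 ha)))

/-! ## §2 `hlongK` / `hlongYK` under proxies (zone at the SEED level `k`, radius `RL + D`) -/

/-- **`hlong` AT EVERY CENTRE UNDER PROXIES, zone at level `k`** (`D ≤ nL`). [cite: KozmaNitzan2024, §4 pp. 19–21] -/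
theorem hlongK_of_atQ3Px {κ : Consts} {V : Type} [DecidableEq V] [Countable V] {G : SimpleGraph V} [G.LocallyFinite] {Φ : PlanarSkeletonFrmQuasi G} {t : V} {p : unitInterval} {hC : Φ.CylSubcritical p} {gv : Neg.FSlot} {fv : Neg.FSlot} {Pv : PSlot} {Sv : SSlot} {cv : CSlot} {bv : BSlot} {O : OutNS V} {q : unitInterval} {D : ℕ} (hAt : (choiceAtQ3 κ Φ t p Pv gv fv Sv cv bv hC).AtQNQ O q) (hP : Φ.HasProxies t D) {a : ℝ} (ha : Neg.δkit κ Φ ≤ a)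
    (hn : D ≤ nL κ Φ t p O.merged (gOf κ Φ t p O gv) (fOf κ Φ t p O fv)) :
    ∀ (c : V) (τ : ℤ), τ = 1 ∨ τ = -1 → 1 - a ^ 3 < (bondPercolation G q).real
      (linkIn (Skelφ.pgramPrism G (φL κ Φ t p O.D O.DT.toDataN O.ori (gOf κ Φ t p O gv) (fOf κ Φ t p O fv)) c
          (nL κ Φ t p O.merged (gOf κ Φ t p O gv) (fOf κ Φ t p O fv)) (hL κ Φ t p O.merged (gOf κ Φ t p O gv) (fOf κ Φ t p O fv))
          (3 * ℓL κ Φ t p O.merged (gOf κ Φ t p O gv) (fOf κ Φ t p O fv)) (RL κ Φ t p O gv fv + D))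
        (O.merged.Λ (hP.prox c) O.merged.k)
        (Skelφ.pgSideHalfW G (φL κ Φ t p O.D O.DT.toDataN O.ori (gOf κ Φ t p O gv) (fOf κ Φ t p O fv)) c
          (nL κ Φ t p O.merged (gOf κ Φ t p O gv) (fOf κ Φ t p O fv)) (hL κ Φ t p O.merged (gOf κ Φ t p O gv) (fOf κ Φ t p O fv))
          (ℓL κ Φ t p O.merged (gOf κ Φ t p O gv) (fOf κ Φ t p O fv)) (RL κ Φ t p O gv fv + D) 1 (1 * τ))) := by
  intro c τ hτ
  obtain ⟨τu, hτu⟩ : ∃ τu : ℤˣ, (τu : ℤ) = τ := by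
    rcases hτ with rfl | rfl
    · exact ⟨1, Units.val_one⟩
    · exact ⟨-1, by simp⟩
  have h := inputsLAt_of_atQPx hAt hP c hn 0 τu
  rw [Skelφ.StepI.eventNAt_some] at h
  unfold Skelφ.StepI.regionNAt Skelφ.StepI.pieceNAt at h
  rw [if_pos rfl, Units.val_one, hτu] at h
  rw [one_mul]
  have hcube := δI3_le_cube_of_le κ Φ ha
  refine lt_of_le_of_lt (by linarith) (h.trans_le (measureReal_mono ?_ (measure_ne_top _ _)))
  exact linkIn_mono le_rfl subset_rfl subset_rfl

/-- **`hlongY` AT EVERY CENTRE UNDER PROXIES, zone at level `k`** (top pieces, split point `vL`; `D ≤ nL`). [cite: KozmaNitzan2024, §4 pp. 19–21] -/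
theorem hlongYK_of_atQ3Px {κ : Consts} {V : Type} [DecidableEq V] [Countable V] {G : SimpleGraph V} [G.LocallyFinite] {Φ : PlanarSkeletonFrmQuasi G} {t : V} {p : unitInterval} {hC : Φ.CylSubcritical p} {gv : Neg.FSlot} {fv : Neg.FSlot} {Pv : PSlot} {Sv : SSlot} {cv : CSlot} {bv : BSlot} {O : OutNS V} {q : unitInterval} {D : ℕ} (hAt : (choiceAtQ3 κ Φ t p Pv gv fv Sv cv bv hC).AtQNQ O q) (hP : Φ.HasProxies t D) {a : ℝ} (ha : Neg.δkit κ Φ ≤ a)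
    (hn : D ≤ nL κ Φ t p O.merged (gOf κ Φ t p O gv) (fOf κ Φ t p O fv)) :
    ∀ (c : V) (τ : ℤ), τ = 1 ∨ τ = -1 → 1 - a ^ 3 < (bondPercolation G q).real
      (linkIn (Skelφ.pgramPrism G (φL κ Φ t p O.D O.DT.toDataN O.ori (gOf κ Φ t p O gv) (fOf κ Φ t p O fv)) c
          (nL κ Φ t p O.merged (gOf κ Φ t p O gv) (fOf κ Φ t p O fv)) (hL κ Φ t p O.merged (gOf κ Φ t p O gv) (fOf κ Φ t p O fv))
          (3 * ℓL κ Φ t p O.merged (gOf κ Φ t p O gv) (fOf κ Φ t p O fv)) (RL κ Φ t p O gv fv + D))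
        (O.merged.Λ (hP.prox c) O.merged.k)
        (Skelφ.pgTopPieceW G (φL κ Φ t p O.D O.DT.toDataN O.ori (gOf κ Φ t p O gv) (fOf κ Φ t p O fv)) c
          (nL κ Φ t p O.merged (gOf κ Φ t p O gv) (fOf κ Φ t p O fv)) (hL κ Φ t p O.merged (gOf κ Φ t p O gv) (fOf κ Φ t p O fv))
          (ℓL κ Φ t p O.merged (gOf κ Φ t p O gv) (fOf κ Φ t p O fv)) (RL κ Φ t p O gv fv + D) 1 τ
          (vL κ Φ t p O.merged (gOf κ Φ t p O gv) (fOf κ Φ t p O fv)))) := by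
  intro c τ hτ
  obtain ⟨τu, hτu⟩ : ∃ τu : ℤˣ, (τu : ℤ) = τ := by
    rcases hτ with rfl | rfl
    · exact ⟨1, Units.val_one⟩
    · exact ⟨-1, by simp⟩
  have h := inputsLAt_of_atQPx hAt hP c hn 1 τu
  rw [Skelφ.StepI.eventNAt_some] at h
  unfold Skelφ.StepI.regionNAt Skelφ.StepI.pieceNAt at h
  rw [if_neg (by decide), Units.val_one, hτu] at h
  have hcube := δI3_le_cube_of_le κ Φ ha
  refine lt_of_le_of_lt (by linarith) (h.trans_le (measureReal_mono ?_ (measure_ne_top _ _)))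
  exact linkIn_mono le_rfl subset_rfl subset_rfl

end ZoneKPx

end NegB

end PlanarSkeletonFrmQuasi

end Summit.CriticalPhenomena.PercolationContinuityZ3.Theorems.Transplant

end
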